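import Literature.MathematicalPhysics.KineticTheory.DiluteCompressibleEulerLimit
import Literature.MathematicalPhysics.KineticTheory.HardSphereEulerProofs
import Literature.Analysis.Asymptotics.LogPowerScale
import HarnessLib

/-!
# The dilute compressible Euler limit (Deng–Hani–Ma 2025, Thm 3 (1)): proved glue

Companion of `Literature.MathematicalPhysics.KineticTheory.deng_hani_ma_compressible_euler`
(`DiluteCompressibleEulerLimit.lean`; arXiv:2503.01800v1 Thm 3 (1), (1.47), PDF p. 11 — a claimed
result recorded as a named fact). This file holds PROVED lemmas only (no statements, no facts).

## What is here, and where it sits in the printed proof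

The printed proof of Thm 3 (1) (ibid. p. 11: "The proof is the same as Theorem 2", whose proof is
on p. 9) has three steps: (i) Prop. 1.8 (Caflisch 1980 / Guo–Jang–Jiang 2010: the Boltzmann
solution `n` with collision rate `α = δ⁻¹` and the Hilbert-expansion datum (1.43) stays within
`≲ δ` of the local Maxwellian of the Euler solution in `L¹`, (1.45)–(1.46)); (ii) Thm 1 (the
long-time Boltzmann–Grad limit on `𝕋ᵈ` with the quantitative rate (1.18), `‖f₁(t) − n(t)‖_{L¹} ≤ ε^θ`
uniformly under (1.16), applied with `α = δ⁻¹` thanks to (1.24)), giving (1.30); (iii) the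
triangle inequality. Step (ii) is consumed in the `α = 1` normalisation of this library
(`TendstoCorrelationsL1`, `LongTimeBoltzmannGradLimit`, activity `bgActivity d ε = ε^{-(d-1)}`),
in which a collision rate `α` is absorbed into the profile `n₀ ↦ α n₀` (`Sweep1`, Design choices).
The lemmas below are the proved form of that absorption for the objects of the fact: the
grand-canonical state with the printed activity `δ⁻¹ ε^{-(d-1)}` ((1.9), (1.25)) and profile `n₀`
is, sector by sector, the state with activity `ε^{-(d-1)}` and profile `δ⁻¹ n₀`
(`gcInitial_const_mul_activity`), and its one-particle correlation function (1.13) is `δ` times the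
`α = 1` one (`correlationFn_one_gcEvolved_inv_mul_activity`). Steps (i) and (ii) themselves are
not in the library (see the session notes of the fact's provefact unit: the fact is triaged XL).

Section `Reduction` then proves the whole printed argument with steps (i) and (ii) as HYPOTHESES:
`deng_hani_ma_compressible_euler_of_thm1_of_prop18` derives the fact from Theorem 1 for `d = 3`,
`s = 1` with its printed admissible region (1.16) and rate (1.18) (hypothesis `hThm1`, stated in the
`α = 1` vocabulary) and Proposition 1.8 for `d = 3` (hypothesis `hProp18`, retaining of the Hilbert
expansion (1.43)–(1.46) the consequences the argument uses); it is a corollary of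
`deng_hani_ma_compressible_euler_of_kinetic_of_hydrodynamic`, the same reduction with the printed
growth `c (log|log ε|)^{1/2}` and rate `ε^θ` abstracted to `R → +∞`, `r → 0`. Neither hypothesis is
vendored as a named fact (D-0026); the section docstring records the rendering clause by clause, so
that a future `LongTimeBoltzmannGradLimit`-with-rate theorem and a Hilbert-expansion theorem
discharge the fact by one application.

## References

* Y. Deng, Z. Hani, X. Ma, *Hilbert's sixth problem: derivation of fluid equations via Boltzmann's
  kinetic theory*, arXiv:2503.01800v1 (2025): (1.9)–(1.10), (1.13) (PDF pp. 5–6), Thm 1 with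
  (1.16)–(1.18) (p. 6), proof of Thm 2, (1.30) (p. 9), Prop. 1.8 and Thm 3 (pp. 10–11). Bib key
  `DengHaniMa2024`.
* I. Gallagher, L. Saint-Raymond, B. Texier, *From Newton to Boltzmann* (2013), (6.1.2)–(6.1.5)
  (bib key `GST2013`): the grand-canonical vocabulary.
* R. E. Caflisch, *The fluid dynamic limit of the nonlinear Boltzmann equation*, Comm. Pure Appl.
  Math. 33 (1980) 651–666 (bib key `Caflisch1980`); Y. Guo, J. Jang, N. Jiang, *Local Hilbert
  expansion for the Boltzmann equation*, Kinet. Relat. Models 2 (2009) 205–214; N. Jiang, Y.-L. Luo,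
  S. Tang, arXiv:2104.11964 (2021): the sources of Prop. 1.8 ([17], [34], [39] of
  arXiv:2503.01800v1), entering here only through the hypothesis `hProp18`.
-/

noncomputable section

open MeasureTheory Filter Set Topology

namespace Literature.MathematicalPhysics.KineticTheory

/-! ### Absorbing the collision rate `α = δ⁻¹` into the profile (glue towards `LongTimeBoltzmannGradLimit`)

The grand-canonical vocabulary of `Sweep1` fixes the Boltzmann–Grad activity `μ_ε = ε^{-(d-1)}`
(`bgActivity`, `α = 1`) and records (module docstring of `Sweep1`, "Design choices") that a general
collision rate `α` is absorbed into the profile, `n₀ ↦ α n₀`, because `gcInitial` is homogeneous and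
`correlationFn` scales like `μ^{-s}`. The statement `deng_hani_ma_compressible_euler` is
written with the printed activity `α ε^{-(d-1)}`, `α = δ⁻¹` (arXiv:2503.01800v1 (1.9), (1.13),
(1.25)); the lemmas below are the proved form of that remark and rewrite its one-particle
correlation function in the `α = 1` vocabulary of `TendstoCorrelationsL1` /
`LongTimeBoltzmannGradLimit` (a factor `δ` in front, profile `δ⁻¹ • n₀`), which is the shape in which
the printed proof of Thm 3 (ibid. p. 11: "the proof is the same as Theorem 2", i.e. Thm 1 applied to
the Boltzmann solution with `α = δ⁻¹`, p. 9 (1.30), plus Prop. 1.8 (1.45)–(1.46)) consumes Thm 1. -/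

section ActivityAbsorption

variable {d : Type*} [Fintype d] {X : Type*} [MeasureSpace X]

omit [Fintype d] [MeasureSpace X] in
/-- Tensor powers are homogeneous of degree `s`: `(c f)^{⊗s} = c^s f^{⊗s}`. [folklore] -/
theorem tensorPow_const_smul (c : ℝ) (s : ℕ) (f : X × EuclideanSpace ℝ d → ℝ)
    (Z : Literature.Analysis.FluidPDE.Config s d X) :
    Literature.Analysis.FluidPDE.tensorPow s (c • f) Z =
      c ^ s * Literature.Analysis.FluidPDE.tensorPow s f Z := by
  simp only [Literature.Analysis.FluidPDE.tensorPow, Pi.smul_apply, smul_eq_mul,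
    Finset.prod_mul_distrib, Finset.prod_const, Finset.card_univ, Fintype.card_fin]

omit [MeasureSpace X] in
/-- The hard-sphere-restricted tensor power is homogeneous of degree `N` in the profile.
[folklore] -/
theorem indicator_tensorPow_const_smul (G : Literature.Analysis.FluidPDE.Geometry d X) (ε c : ℝ)
    (N : ℕ) (f : X × EuclideanSpace ℝ d → ℝ) (z : Literature.Analysis.FluidPDE.Config N d X) :
    (Literature.Analysis.FluidPDE.hardSphereDomain G N ε).indicator
        (Literature.Analysis.FluidPDE.tensorPow N (c • f)) z =
      c ^ N * (Literature.Analysis.FluidPDE.hardSphereDomain G N ε).indicator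
        (Literature.Analysis.FluidPDE.tensorPow N f) z := by
  by_cases hz : z ∈ Literature.Analysis.FluidPDE.hardSphereDomain G N ε
  · simp only [Set.indicator_of_mem hz, tensorPow_const_smul]
  · simp only [Set.indicator_of_notMem hz, mul_zero]

/-- The canonical partition function is homogeneous of degree `N` in the profile:
`𝒵_N[c f₀] = c^N 𝒵_N[f₀]` (GST 2013 (6.1.2)). [folklore] -/
theorem canonicalPartition_const_smul (G : Literature.Analysis.FluidPDE.Geometry d X) (ε c : ℝ)
    (N : ℕ) (f₀ : X × EuclideanSpace ℝ d → ℝ) :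
    Literature.Analysis.FluidPDE.canonicalPartition G ε N (c • f₀) =
      c ^ N * Literature.Analysis.FluidPDE.canonicalPartition G ε N f₀ := by
  simp only [Literature.Analysis.FluidPDE.canonicalPartition, indicator_tensorPow_const_smul,
    integral_const_mul]

/-- Scaling the profile is scaling the activity in the grand-canonical partition function:
`𝒵^ε_μ[c f₀] = 𝒵^ε_{cμ}[f₀]` (arXiv:2503.01800v1 (1.10) with `α ε^{-(d-1)} = c μ`). [folklore] -/
theorem gcPartition_const_smul (G : Literature.Analysis.FluidPDE.Geometry d X) (ε μ c : ℝ)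
    (f₀ : X × EuclideanSpace ℝ d → ℝ) :
    Literature.Analysis.FluidPDE.gcPartition G ε μ (c • f₀) =
      Literature.Analysis.FluidPDE.gcPartition G ε (c * μ) f₀ := by
  simp only [Literature.Analysis.FluidPDE.gcPartition, canonicalPartition_const_smul, mul_pow]
  refine tsum_congr fun N => ?_
  ring

/-- **Absorbing the collision rate into the profile.** The grand-canonical Gibbs-type state with
activity `c μ` and profile `f₀` *is* the state with activity `μ` and profile `c f₀`, sector by
sector: `(𝒵)⁻¹ (cμ)^N 1_{D} f₀^{⊗N} = (𝒵)⁻¹ μ^N 1_{D} (c f₀)^{⊗N}` (arXiv:2503.01800v1 (1.9) with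
`α = c`; `Sweep1`, Design choices: "a general `α` is absorbed into `f₀ ↦ α f₀`"). No sign or
integrability hypothesis is needed: it is an algebraic identity of the series and products.
[folklore] -/
theorem gcInitial_const_mul_activity (G : Literature.Analysis.FluidPDE.Geometry d X) (ε μ c : ℝ)
    (f₀ : X × EuclideanSpace ℝ d → ℝ) :
    Literature.Analysis.FluidPDE.gcInitial G ε (c * μ) f₀ =
      Literature.Analysis.FluidPDE.gcInitial G ε μ (c • f₀) := by
  funext N z
  simp only [Literature.Analysis.FluidPDE.gcInitial, gcPartition_const_smul,
    indicator_tensorPow_const_smul, mul_pow]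
  ring

/-- The rescaled correlation functions scale like `μ^{-s}` in the activity:
`F^{(s)}_{cμ}[W] = c^{-s} F^{(s)}_μ[W]` for the same grand-canonical state `W`
(arXiv:2503.01800v1 (1.13): the prefactor `(α⁻¹ ε^{d-1})^s`). [folklore] -/
theorem correlationFn_const_mul_activity (c μ : ℝ) (W : Literature.Analysis.FluidPDE.GCState d X)
    (s : ℕ) (Zs : Literature.Analysis.FluidPDE.Config s d X) :
    Literature.Analysis.FluidPDE.correlationFn (c * μ) W s Zs =
      (c ^ s)⁻¹ * Literature.Analysis.FluidPDE.correlationFn μ W s Zs := by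
  simp only [Literature.Analysis.FluidPDE.correlationFn, mul_pow, mul_inv, mul_assoc]

/-- **The one-particle correlation function of `deng_hani_ma_compressible_euler` in the `α = 1`
vocabulary.** For any geometry, diameter `ε`, Knudsen number `δ`, profile `n₀`, sector flows `Φ`
and time `t`: the time-evolved one-particle correlation function of the grand-canonical state with
the printed activity `δ⁻¹ μ` (`μ` arbitrary, in the statement above `μ = bgActivity (Fin 3) ε`) and
profile `n₀` equals `δ` times that of the state with activity `μ` and profile `δ⁻¹ • n₀` — the
object about which `TendstoCorrelationsL1` (`s = 1`) and `LongTimeBoltzmannGradLimit` speak, for the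
Boltzmann solution with `α = 1` issued from `δ⁻¹ n₀` (arXiv:2503.01800v1 p. 9, (1.30), as used on
p. 11 in the proof of Thm 3). [folklore] -/
theorem correlationFn_one_gcEvolved_inv_mul_activity {G : Literature.Analysis.FluidPDE.Geometry d X}
    [TopologicalSpace X] {ε : ℝ} (Φ : (N : ℕ) → Literature.Analysis.FluidPDE.HardSphereFlow G ε N)
    (δ μ : ℝ) (n₀ : X × EuclideanSpace ℝ d → ℝ) (t : ℝ)
    (Z : Literature.Analysis.FluidPDE.Config 1 d X) :
    Literature.Analysis.FluidPDE.correlationFn (δ⁻¹ * μ)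
        (gcEvolved Φ (Literature.Analysis.FluidPDE.gcInitial G ε (δ⁻¹ * μ) n₀) t) 1 Z =
      δ * Literature.Analysis.FluidPDE.correlationFn μ
        (gcEvolved Φ (Literature.Analysis.FluidPDE.gcInitial G ε μ (δ⁻¹ • n₀)) t) 1 Z := by
  rw [correlationFn_const_mul_activity, gcInitial_const_mul_activity, pow_one, inv_inv]

end ActivityAbsorption

/-! ### The printed proof of Theorem 3 (1) as a reduction: Thm 1 (with rate) + Prop. 1.8 ⟹ the fact

arXiv:2503.01800v1, p. 11: "The proof [of Theorem 3] is the same as Theorem 2", and p. 9 (proof of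
Theorem 2 (1)): "by Proposition 1.6 [here: 1.8] we get the estimates (1.22)–(1.23) [here:
(1.45)–(1.46)] for the solution `n` to the Boltzmann equation. Using this information and the
assumption (1.24), we see that the assumption (1.16) in Theorem 1 is satisfied … by applying
Theorem 1 we get `‖f₁(t) − n(t)‖_{L¹_{x,v}} ≤ ε^θ` (1.30) … The desired bound then follows from (1.30)
and (1.22)–(1.23)" — i.e. the triangle inequality in `L¹`. The two theorems below are exactly this
argument, machine-checked, with its two INPUTS kept as hypotheses (they are distinct published
results that the library does not hold; D-0026: they are not restated here as named facts):

* `hThm1` / `hkin` — **Theorem 1** (ibid. p. 6, (1.16)–(1.18); arXiv:2408.07818 Thm 1) for `d = 3`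
  and `s = 1`, in the `α = 1` vocabulary of `Sweep1` (collision rate absorbed into the profile,
  `f = α n`, so that `∫ f(0) = α`, the bounds (1.17) read `≤ αA`, the grand-canonical datum (1.9) is
  `gcInitial 𝕋³ ε ε⁻² (f 0)` by `gcInitial_const_mul_activity`, and (1.18) for `s = 1` reads
  `‖F₁(t) − f(t)‖_{L¹} ≤ α ε^θ`, `F₁ = correlationFn ε⁻² (…) 1 = α f₁` by
  `correlationFn_const_mul_activity`). Rendering choices, each a weakening of the print or the
  library's standing convention: Gaussian weights in the `X_β` convention `e^{β|v|²/2}` of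
  `eGaussSupNorm` / `IsDHMAdmissibleSolution` (print: `e^{2β|v|²}`; `β` is universally quantified,
  so this is a renaming); the `L^∞` bounds (1.17) as pointwise bounds, the gradient bound on the datum
  as a weighted Lipschitz bound for Mathlib's distance on `UnitAddTorus (Fin 3)` (as in
  `IsDHMAdmissibleSolution.lipschitz`); "the solution to (1.15) exists on `[0, t_fin]`" as the
  library's `IsMildBoltzmannSolutionOn` (as in `lanford`, `LongTimeBoltzmannGradLimit`); `α ≥ 1`
  only (print: any `α`, through `max(1, α)`); `θ`, `ε₀` allowed to depend on `β` (print: `θ = θ(d)`).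
  `hThm1` keeps the printed admissible region (1.16), `max(1,α)·max(1,A)·max(1,t_fin) ≤
  c (log|log ε|)^{1/2}` for `ε ≤ ε₀(β)`, and the printed rate `ε^θ`; `hkin` is the same statement
  with the two printed functions abstracted to a growth `R → +∞` and a rate `r → 0` at `0⁺`
  (`tendsto_const_mul_sqrt_log_abs_log` and
  `Literature.Analysis.Asymptotics.tendsto_rpow_nhdsGT_zero_of_pos` show that the printed ones
  qualify), which is all the argument uses.
* `hProp18` / `hhyd` — **Proposition 1.8** (ibid. p. 10, (1.40)–(1.46): Caflisch 1980,
  Guo–Jang–Jiang 2009, Jiang–Luo–Tang 2021) for `d = 3` and the library's classical ideal-gas Euler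
  solutions `IsHardSphereEulerSolution 0 T` (`p = ρθ`, `E = ρ(3θ + |u|²)/2` = (1.40)), on a closed
  horizon `[0, T'] ⊂ [0, T)`, together with the printed sentence "we may choose the initial data of
  `(ρₙ, uₙ, Tₙ)` and `F_R` suitably, to make `n₀` nonnegative and satisfy `∫ n₀ = 1`", retaining of
  the Hilbert expansion (1.43)/(1.45) only the consequences the argument uses: for `0 < δ ≤ δ₀` the
  Boltzmann solution `n^δ` with collision rate `δ⁻¹` (i.e. `δ⁻¹ n^δ` solves the `α = 1` equation)
  exists on `[0, T']`, has `∫ n^δ(0) = 1`, obeys (1.17) with constants `(β, A₀)` INDEPENDENT of `δ`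
  (from (1.45)–(1.46): the `Fⱼ` are Maxwellian-dominated up to polynomial weights and
  `|h| ≲ δ^{3/2} M^{1/2}`, so some `β > 0` depending on `sup θ`, `sup |u|` over `[0, T'] × 𝕋³` works
  for all `δ ≤ δ₀` — p. 11: "the value of `β > 0` should depend on [`T`]"), has measurable time
  slices, and stays within `C δ` of the local Maxwellian (1.41) in `L¹` (from (1.45)–(1.46):
  `n − M = ∑_{j ≥ 1} δʲ Fⱼ + h`).

Given these, `deng_hani_ma_compressible_euler` follows (`…_of_thm1_of_prop18`, via
`…_of_kinetic_of_hydrodynamic`): datum `n₀^δ := n^{min(δ,δ₀)}(0)`; growth function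
`A(e) := R(e) / (max(1,A₀) max(1,T'))`, so that admissibility `δ_k⁻¹ ≤ A(ε_k)` is (1.16) for
`(α, A, t_fin) = (δ_k⁻¹, A₀, T')` once `δ_k ≤ 1`; then for `δ_k ≤ min(δ₀, 1)` the one-particle
correlation function of the fact is `δ_k F₁` (`correlationFn_one_gcEvolved_inv_mul_activity`),
`δ_k F₁ − M = δ_k (F₁ − δ_k⁻¹ n^{δ_k}) + (n^{δ_k} − M)` pointwise, and
`‖·‖_{L¹} ≤ δ_k · δ_k⁻¹ r(ε_k) + C δ_k → 0`. What remains for `deng_hani_ma_compressible_euler_holds`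
is therefore precisely: Theorem 1 with its rate (an apex-sized claim; the library's qualitative
`LongTimeBoltzmannGradLimit (Fin 3)` does NOT suffice — it fixes the Boltzmann solution before
letting `ε → 0`, whereas here `δ → 0` jointly) and Proposition 1.8 (a litbuild-sized story: the
linearised Boltzmann operator `L⁻¹`, the expansion (1.42), the remainder equation). -/

section Reduction

open Literature.Analysis.FluidPDE (Config correlationFn gcInitial HardSphereFlow
  IsMildBoltzmannSolutionOn Torus.geometry)

/-- Time slices of the local Maxwellian `ρ(t,x) M_{1,u(t,x),θ(t,x)}(v)` of a classical Euler
solution are measurable on `𝕋³ × ℝ³` (continuity of the slices, `measurable_localGibbsProfile`).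
[folklore] -/
theorem IsHardSphereEulerSolution.measurable_localGibbsProfile {σ T : ℝ} {ρ θ : ℝ → T3 → ℝ}
    {u : ℝ → T3 → V3} (hE : IsHardSphereEulerSolution σ T ρ u θ) {t : ℝ} (ht : t ∈ Ico 0 T) :
    Measurable (localGibbsProfile (ρ t) (u t) (θ t)) :=
  KineticTheory.measurable_localGibbsProfile (hE.smooth_density.isSmooth_slice ht).continuous
    (hE.smooth_temperature.isSmooth_slice ht).continuous
    (hE.smooth_velocity.isSmooth_slice ht).continuous

/-- One-particle configurations: integrating a function of `z 0` over `Config 1 (Fin 3) 𝕋³`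
(`= Fin 1 → 𝕋³ × ℝ³` with the product `volume`) is integrating over the one-particle phase space
(`MeasureTheory.volume_preserving_funUnique`). [folklore] -/
theorem lintegral_config_one (h : T3 × V3 → ENNReal) :
    ∫⁻ z : Config 1 (Fin 3) T3, h (z 0) = ∫⁻ y, h y := by
  rw [(volume_preserving_funUnique (Fin 1) (T3 × V3)).lintegral_map_equiv h
    (MeasurableEquiv.funUnique (Fin 1) (T3 × V3))]
  rfl

/-- The printed admissible growth of arXiv:2503.01800v1 (1.16)/(1.24), `c (log|log ε|)^{1/2}` with
`c > 0` the implicit constant, diverges as `ε → 0⁺`. [folklore] -/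
theorem tendsto_const_mul_sqrt_log_abs_log {c : ℝ} (hc : 0 < c) :
    Tendsto (fun e : ℝ => c * Real.sqrt (Real.log |Real.log e|)) (𝓝[>] 0) atTop :=
  Tendsto.const_mul_atTop hc (Real.tendsto_sqrt_atTop.comp (Real.tendsto_log_atTop.comp
    (tendsto_abs_atBot_atTop.comp Real.tendsto_log_nhdsGT_zero)))

/-- **Deng–Hani–Ma, Theorem 3 (1), from its two printed inputs (abstract-rate form).** The
printed proof of arXiv:2503.01800v1 Thm 3 (1) (p. 11 → proof of Thm 2 (1), p. 9: Prop. 1.8, then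
Thm 1 under (1.16)/(1.24), then the triangle inequality (1.30) + (1.45)–(1.46)), with its inputs as
hypotheses (see the section docstring for the rendering, clause by clause):
`hkin` = Theorem 1 (ibid. p. 6; arXiv:2408.07818 Thm 1) for `d = 3`, `s = 1`, in the `α = 1`
vocabulary (`f = α n`), with the admissible region (1.16) abstracted to a growth function
`R → +∞` and the rate (1.18) to `r → 0` at `0⁺` — for every `β > 0` there are such `R, r` with: for
all `α ≥ 1`, `A`, `t_fin`, every mild solution `f` of the hard-sphere Boltzmann equation on `𝕋³` on
`[0, t_fin]` with `∫ f(0) = α`, `e^{β|v|²/2} |f(t,x,v)| ≤ αA` on `[0, t_fin]` and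
`|f(0,x,v) − f(0,y,v)| ≤ αA · dist(x,y) · e^{−β|v|²/2}`, every `ε > 0` with
`max(1,α) max(1,A) max(1,t_fin) ≤ R(ε)`, all hard-sphere flows and all `t ∈ [0, t_fin]`,
`‖F₁(t) − f(t)‖_{L¹} ≤ α r(ε)`, `F₁(t)` the one-particle correlation function of the grand-canonical
state with activity `ε⁻²` and profile `f(0)` evolved to time `t`;
`hhyd` = Proposition 1.8 (ibid. p. 10; Caflisch 1980, Guo–Jang–Jiang 2009) for `d = 3`: for every
classical ideal-gas Euler solution with `∫ ρ(0) = 1` and every closed horizon `[0, T'] ⊂ [0, T)`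
there are `β > 0`, `A₀`, `C`, `δ₀ > 0` and Boltzmann solutions `n^δ` with collision rate `δ⁻¹`
(`δ⁻¹ n^δ` is a mild solution of the `α = 1` equation on `[0, T']`), `0 < δ ≤ δ₀`, with
`∫ n^δ(0) = 1`, the bounds (1.17) with `(β, A₀)` uniformly in `δ`, measurable time slices, and
`‖n^δ(t) − ρ(t) M_{1,u(t),θ(t)}‖_{L¹} ≤ C δ` on `[0, T']`.
Conclusion: `deng_hani_ma_compressible_euler`. [cite: DengHaniMa2024, arXiv:2503.01800v1 Thm 3 (1),
proof p. 11 with p. 9 (1.30)] -/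
theorem deng_hani_ma_compressible_euler_of_kinetic_of_hydrodynamic
    (hkin : ∀ β : ℝ, 0 < β → ∃ R r : ℝ → ℝ,
      Tendsto R (𝓝[>] 0) atTop ∧ Tendsto r (𝓝[>] 0) (𝓝 0) ∧
      ∀ (α A tfin : ℝ) (f : ℝ → T3 → V3 → ℝ), 1 ≤ α →
        IsMildBoltzmannSolutionOn tfin (Torus.geometry (Fin 3)) hardSphereKernel f →
        (∫ z : T3 × V3, f 0 z.1 z.2 = α) →
        (∀ t ∈ Icc 0 tfin, ∀ x v, Real.exp (β / 2 * ‖v‖ ^ 2) * |f t x v| ≤ α * A) →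
        (∀ x y v, |f 0 x v - f 0 y v| ≤ α * A * dist x y * Real.exp (-(β / 2) * ‖v‖ ^ 2)) →
        ∀ ε : ℝ, 0 < ε → max 1 α * max 1 A * max 1 tfin ≤ R ε →
        ∀ Φ : (N : ℕ) → HardSphereFlow (Torus.geometry (Fin 3)) ε N, ∀ t ∈ Icc 0 tfin,
          eLpNorm (correlationFn (bgActivity (Fin 3) ε)
              (gcEvolved Φ (gcInitial (Torus.geometry (Fin 3)) ε (bgActivity (Fin 3) ε)
                (Function.uncurry (f 0))) t) 1 -
            fun z => f t (z 0).1 (z 0).2) 1 volume ≤ ENNReal.ofReal (α * r ε))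
    (hhyd : ∀ (T : ℝ) (ρ θ : ℝ → T3 → ℝ) (u : ℝ → T3 → V3), IsHardSphereEulerSolution 0 T ρ u θ →
      (∫ x, ρ 0 x = 1) → ∀ T' : ℝ, 0 ≤ T' → T' < T →
      ∃ β A₀ C δ₀ : ℝ, 0 < β ∧ 0 < δ₀ ∧ ∃ n : ℝ → ℝ → T3 → V3 → ℝ, ∀ δ : ℝ, 0 < δ → δ ≤ δ₀ →
        IsMildBoltzmannSolutionOn T' (Torus.geometry (Fin 3)) hardSphereKernel
          (fun t => δ⁻¹ • n δ t) ∧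
        (∫ z : T3 × V3, n δ 0 z.1 z.2 = 1) ∧
        (∀ t ∈ Icc 0 T', ∀ x v, Real.exp (β / 2 * ‖v‖ ^ 2) * |n δ t x v| ≤ A₀) ∧
        (∀ x y v, |n δ 0 x v - n δ 0 y v| ≤ A₀ * dist x y * Real.exp (-(β / 2) * ‖v‖ ^ 2)) ∧
        (∀ t ∈ Icc 0 T', Measurable (Function.uncurry (n δ t))) ∧
        (∀ t ∈ Icc 0 T', eLpNorm (fun z : T3 × V3 =>
            n δ t z.1 z.2 - localGibbsProfile (ρ t) (u t) (θ t) z) 1 volume ≤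
            ENNReal.ofReal (C * δ))) :
    deng_hani_ma_compressible_euler := by
  intro T ρ θ u hE hmass T' hT'0 hT'T
  obtain ⟨β, A₀, C, δ₀, hβ, hδ₀, n, hn⟩ := hhyd T ρ θ u hE hmass T' hT'0 hT'T
  obtain ⟨R, r, hR, hr, hkin⟩ := hkin β hβ
  -- the `(β, d)`-independent part of (1.16): `K = max(1, A) · max(1, t_fin)`
  set K : ℝ := max 1 A₀ * max 1 T' with hK_def
  have hK : 0 < K :=
    mul_pos (lt_of_lt_of_le one_pos (le_max_left _ _)) (lt_of_lt_of_le one_pos (le_max_left _ _))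
  have h0T' : (0 : ℝ) ∈ Icc 0 T' := ⟨le_rfl, hT'0⟩
  refine ⟨fun δ => Function.uncurry (n (min δ δ₀) 0), ?_, ?_, fun e => R e / K,
    hR.atTop_div_const hK, ?_⟩
  · -- the datum is a probability density for every `δ > 0`
    intro δ hδ
    have hδ' : 0 < min δ δ₀ := lt_min hδ hδ₀
    obtain ⟨hmild, hint, -, -, -, -⟩ := hn (min δ δ₀) hδ' (min_le_right _ _)
    refine ⟨fun z => ?_, hint⟩
    have h0 := hmild.nonneg 0 h0T' z.1 z.2
    simp only [Pi.smul_apply, smul_eq_mul] at h0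
    exact (mul_nonneg_iff_of_pos_left (inv_pos.2 hδ')).1 h0
  · -- the datum is `L¹`-close to the initial local Maxwellian (hydrodynamic closeness at `t = 0`)
    refine ⟨max C 0, δ₀, hδ₀, fun δ hδ hδδ₀ => ?_⟩
    have hmin : min δ δ₀ = δ := min_eq_left hδδ₀
    obtain ⟨-, -, -, -, hmeas, hclose⟩ := hn δ hδ hδδ₀
    have hG : Measurable (localGibbsProfile (ρ 0) (u 0) (θ 0)) :=
      hE.measurable_localGibbsProfile ⟨le_rfl, lt_of_le_of_lt hT'0 hT'T⟩
    have hdm : Measurable fun z : T3 × V3 =>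
        n δ 0 z.1 z.2 - localGibbsProfile (ρ 0) (u 0) (θ 0) z := (hmeas 0 h0T').sub hG
    have hfin := hclose 0 h0T'
    have key := integral_norm_eq_lintegral_enorm hdm.aestronglyMeasurable (μ := volume)
    rw [← eLpNorm_one_eq_lintegral_enorm] at key
    simp only [hmin]
    calc ∫ z : T3 × V3, |n δ 0 z.1 z.2 - localGibbsProfile (ρ 0) (u 0) (θ 0) z|
        = (eLpNorm (fun z : T3 × V3 =>
            n δ 0 z.1 z.2 - localGibbsProfile (ρ 0) (u 0) (θ 0) z) 1 volume).toReal := key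
      _ ≤ (ENNReal.ofReal (C * δ)).toReal := ENNReal.toReal_mono ENNReal.ofReal_ne_top hfin
      _ = max (C * δ) 0 := ENNReal.toReal_ofReal'
      _ ≤ max C 0 * δ := max_le (mul_le_mul_of_nonneg_right (le_max_left _ _) hδ.le)
          (mul_nonneg (le_max_right _ _) hδ.le)
  · -- the joint limit
    intro ε δ hεpos hεlim hδpos hδlim hadm Φ t ht
    have htIco : t ∈ Ico 0 T := ⟨ht.1, lt_of_le_of_lt ht.2 hT'T⟩
    have hG : Measurable (localGibbsProfile (ρ t) (u t) (θ t)) :=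
      hE.measurable_localGibbsProfile htIco
    -- eventually `δ_k ≤ min(δ₀, 1)`
    have hev : ∀ᶠ k in atTop, δ k < min δ₀ 1 :=
      hδlim.eventually (Iio_mem_nhds (lt_min hδ₀ one_pos))
    have hεwithin : Tendsto ε atTop (𝓝[>] 0) :=
      tendsto_nhdsWithin_iff.2 ⟨hεlim, Eventually.of_forall hεpos⟩
    -- the upper bound `r(ε_k) + max(C,0) δ_k → 0`
    have hupper : Tendsto (fun k => ENNReal.ofReal (r (ε k)) + ENNReal.ofReal (max C 0 * δ k))
        atTop (𝓝 0) := by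
      have h1 : Tendsto (fun k => ENNReal.ofReal (r (ε k))) atTop (𝓝 0) := by
        simpa using ENNReal.tendsto_ofReal (hr.comp hεwithin)
      have h2 : Tendsto (fun k => ENNReal.ofReal (max C 0 * δ k)) atTop (𝓝 0) := by
        simpa using ENNReal.tendsto_ofReal (hδlim.const_mul (max C 0))
      simpa using h1.add h2
    refine tendsto_of_tendsto_of_tendsto_of_le_of_le' tendsto_const_nhds hupper
      (Eventually.of_forall fun _ => bot_le) (hev.mono fun k hk => ?_)
    -- the estimate at a fixed index `k` with `δ_k ≤ min(δ₀, 1)`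
    have hk0 : δ k ≤ δ₀ := hk.le.trans (min_le_left _ _)
    have hk1 : δ k ≤ 1 := hk.le.trans (min_le_right _ _)
    have hd : 0 < δ k := hδpos k
    have hdinv : 1 ≤ (δ k)⁻¹ := (one_le_inv₀ hd).2 hk1
    obtain ⟨hmild, hint, hbound, hlip, hmeas, hclose⟩ := hn (δ k) hd hk0
    have hmin : min (δ k) δ₀ = δ k := min_eq_left hk0
    -- Theorem 1 applied to `f = δ⁻¹ n` (collision rate absorbed), (1.16) supplied by admissibility
    have hkb : eLpNorm (correlationFn (bgActivity (Fin 3) (ε k))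
        (gcEvolved (Φ k) (gcInitial (Torus.geometry (Fin 3)) (ε k) (bgActivity (Fin 3) (ε k))
          ((δ k)⁻¹ • Function.uncurry (n (δ k) 0))) t) 1 -
        fun z => (δ k)⁻¹ * n (δ k) t (z 0).1 (z 0).2) 1 volume ≤
        ENNReal.ofReal ((δ k)⁻¹ * r (ε k)) := by
      refine hkin (δ k)⁻¹ A₀ T' (fun t => (δ k)⁻¹ • n (δ k) t) hdinv hmild ?_ ?_ ?_ (ε k) (hεpos k)
        ?_ (Φ k) t ht
      · show ∫ z : T3 × V3, (δ k)⁻¹ * n (δ k) 0 z.1 z.2 = (δ k)⁻¹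
        rw [integral_const_mul, hint, mul_one]
      · intro s hs x v
        show Real.exp (β / 2 * ‖v‖ ^ 2) * |(δ k)⁻¹ * n (δ k) s x v| ≤ (δ k)⁻¹ * A₀
        rw [abs_mul, abs_of_pos (inv_pos.2 hd), mul_left_comm]
        exact mul_le_mul_of_nonneg_left (hbound s hs x v) (inv_pos.2 hd).le
      · intro x y v
        show |(δ k)⁻¹ * n (δ k) 0 x v - (δ k)⁻¹ * n (δ k) 0 y v| ≤
          (δ k)⁻¹ * A₀ * dist x y * Real.exp (-(β / 2) * ‖v‖ ^ 2)
        rw [← mul_sub, abs_mul, abs_of_pos (inv_pos.2 hd), mul_assoc, mul_assoc]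
        refine mul_le_mul_of_nonneg_left ?_ (inv_pos.2 hd).le
        simpa [mul_assoc] using hlip x y v
      · rw [max_eq_right hdinv, mul_assoc]
        exact (le_div_iff₀ hK).1 (hadm k)
    -- measurability of the hydrodynamic error on one-particle configurations
    have hNG : Measurable fun z : Config 1 (Fin 3) T3 =>
        ‖n (δ k) t (z 0).1 (z 0).2 - localGibbsProfile (ρ t) (u t) (θ t) (z 0)‖ₑ :=
      (((hmeas t ht).comp (measurable_pi_apply 0)).sub (hG.comp (measurable_pi_apply 0))).enorm
    -- hydrodynamic closeness transported to `Config 1`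
    have hhc : ∫⁻ z : Config 1 (Fin 3) T3,
        ‖n (δ k) t (z 0).1 (z 0).2 - localGibbsProfile (ρ t) (u t) (θ t) (z 0)‖ₑ ≤
        ENNReal.ofReal (max C 0 * δ k) := by
      rw [lintegral_config_one fun y : T3 × V3 =>
        ‖n (δ k) t y.1 y.2 - localGibbsProfile (ρ t) (u t) (θ t) y‖ₑ]
      refine (le_of_eq_of_le eLpNorm_one_eq_lintegral_enorm.symm (hclose t ht)).trans ?_
      exact ENNReal.ofReal_le_ofReal (mul_le_mul_of_nonneg_right (le_max_left _ _) hd.le)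
    -- pointwise splitting `f₁ - M = δ (F₁ - δ⁻¹ n) + (n - M)` after activity absorption
    simp only [hmin]
    rw [eLpNorm_one_eq_lintegral_enorm]
    calc ∫⁻ z : Config 1 (Fin 3) T3, ‖(correlationFn ((δ k)⁻¹ * bgActivity (Fin 3) (ε k))
            (gcEvolved (Φ k) (gcInitial (Torus.geometry (Fin 3)) (ε k)
              ((δ k)⁻¹ * bgActivity (Fin 3) (ε k))
              (Function.uncurry (n (δ k) 0))) t) 1 -
            fun z : Config 1 (Fin 3) T3 => localGibbsProfile (ρ t) (u t) (θ t) (z 0)) z‖ₑ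
        ≤ ∫⁻ z : Config 1 (Fin 3) T3, ENNReal.ofReal (δ k) *
            ‖(correlationFn (bgActivity (Fin 3) (ε k))
              (gcEvolved (Φ k) (gcInitial (Torus.geometry (Fin 3)) (ε k) (bgActivity (Fin 3) (ε k))
                ((δ k)⁻¹ • Function.uncurry (n (δ k) 0))) t) 1 -
              fun z : Config 1 (Fin 3) T3 => (δ k)⁻¹ * n (δ k) t (z 0).1 (z 0).2) z‖ₑ +
            ‖n (δ k) t (z 0).1 (z 0).2 - localGibbsProfile (ρ t) (u t) (θ t) (z 0)‖ₑ := by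
          refine lintegral_mono fun z => ?_
          rw [Pi.sub_apply, Pi.sub_apply, correlationFn_one_gcEvolved_inv_mul_activity,
            ← Real.enorm_of_nonneg hd.le, ← enorm_mul]
          refine le_of_eq_of_le ?_ (enorm_add_le _ _)
          congr 1
          field_simp
          ring
      _ = ENNReal.ofReal (δ k) * (∫⁻ z : Config 1 (Fin 3) T3,
            ‖(correlationFn (bgActivity (Fin 3) (ε k))
              (gcEvolved (Φ k) (gcInitial (Torus.geometry (Fin 3)) (ε k) (bgActivity (Fin 3) (ε k))
                ((δ k)⁻¹ • Function.uncurry (n (δ k) 0))) t) 1 -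
              fun z : Config 1 (Fin 3) T3 => (δ k)⁻¹ * n (δ k) t (z 0).1 (z 0).2) z‖ₑ) +
            ∫⁻ z : Config 1 (Fin 3) T3,
              ‖n (δ k) t (z 0).1 (z 0).2 - localGibbsProfile (ρ t) (u t) (θ t) (z 0)‖ₑ := by
          rw [lintegral_add_right _ hNG, lintegral_const_mul' _ _ ENNReal.ofReal_ne_top]
      _ ≤ ENNReal.ofReal (δ k) * ENNReal.ofReal ((δ k)⁻¹ * r (ε k)) +
            ENNReal.ofReal (max C 0 * δ k) := by
          refine add_le_add (mul_le_mul_of_nonneg_left ?_ bot_le) hhc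
          rw [← eLpNorm_one_eq_lintegral_enorm]
          exact hkb
      _ = ENNReal.ofReal (r (ε k)) + ENNReal.ofReal (max C 0 * δ k) := by
          rw [← ENNReal.ofReal_mul hd.le, mul_inv_cancel_left₀ hd.ne']

/-- **Deng–Hani–Ma, Theorem 3 (1), from its two printed inputs (printed form of Theorem 1).**
As `deng_hani_ma_compressible_euler_of_kinetic_of_hydrodynamic`, with the kinetic input stated
with the PRINTED admissible region and rate of arXiv:2503.01800v1 Thm 1 (p. 6): for every `β > 0`
there are `c > 0` (the implicit constant of (1.16), depending on `β` and `d = 3`), `θ > 0` (the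
exponent of (1.18)) and `ε₀ > 0` ("`ε` small enough depending on `(β, d)` and the implicit
constant") such that for all `α ≥ 1`, `A`, `t_fin` and every mild Boltzmann solution `f = α n` on
`𝕋³` on `[0, t_fin]` with `∫ f(0) = α` and the bounds (1.17) (`e^{β|v|²/2}|f| ≤ αA` on `[0, t_fin]`,
`|f(0,x,v) − f(0,y,v)| ≤ αA·dist(x,y)·e^{−β|v|²/2}`): if `0 < ε ≤ ε₀` and
`max(1,α)·max(1,A)·max(1,t_fin) ≤ c (log|log ε|)^{1/2}` (1.16), then for all hard-sphere flows and
`t ∈ [0, t_fin]`, `‖F₁(t) − f(t)‖_{L¹((𝕋³ × ℝ³)^1)} ≤ α ε^θ` ((1.18) for `s = 1`; `F₁ = α f₁`,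
`f = α n`). `hProp18` is Proposition 1.8 rendered as in `…_of_kinetic_of_hydrodynamic`. The printed
growth and rate qualify for the abstract form by `tendsto_const_mul_sqrt_log_abs_log` and
`Literature.Analysis.Asymptotics.tendsto_rpow_nhdsGT_zero_of_pos` (the growth function is cut off
to `0` above `ε₀`, which forces `ε ≤ ε₀` since the left side of (1.16) is `≥ 1`).
[cite: DengHaniMa2024, arXiv:2503.01800v1 Thm 1 (1.16)–(1.18) p. 6, Prop. 1.8 p. 10,
Thm 3 (1) p. 11] -/
theorem deng_hani_ma_compressible_euler_of_thm1_of_prop18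
    (hThm1 : ∀ β : ℝ, 0 < β → ∃ c θ ε₀ : ℝ, 0 < c ∧ 0 < θ ∧ 0 < ε₀ ∧
      ∀ (α A tfin : ℝ) (f : ℝ → T3 → V3 → ℝ), 1 ≤ α →
        IsMildBoltzmannSolutionOn tfin (Torus.geometry (Fin 3)) hardSphereKernel f →
        (∫ z : T3 × V3, f 0 z.1 z.2 = α) →
        (∀ t ∈ Icc 0 tfin, ∀ x v, Real.exp (β / 2 * ‖v‖ ^ 2) * |f t x v| ≤ α * A) →
        (∀ x y v, |f 0 x v - f 0 y v| ≤ α * A * dist x y * Real.exp (-(β / 2) * ‖v‖ ^ 2)) →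
        ∀ ε : ℝ, 0 < ε → ε ≤ ε₀ →
          max 1 α * max 1 A * max 1 tfin ≤ c * Real.sqrt (Real.log |Real.log ε|) →
        ∀ Φ : (N : ℕ) → HardSphereFlow (Torus.geometry (Fin 3)) ε N, ∀ t ∈ Icc 0 tfin,
          eLpNorm (correlationFn (bgActivity (Fin 3) ε)
              (gcEvolved Φ (gcInitial (Torus.geometry (Fin 3)) ε (bgActivity (Fin 3) ε)
                (Function.uncurry (f 0))) t) 1 -
            fun z => f t (z 0).1 (z 0).2) 1 volume ≤ ENNReal.ofReal (α * ε ^ θ))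
    (hProp18 : ∀ (T : ℝ) (ρ θ : ℝ → T3 → ℝ) (u : ℝ → T3 → V3), IsHardSphereEulerSolution 0 T ρ u θ →
      (∫ x, ρ 0 x = 1) → ∀ T' : ℝ, 0 ≤ T' → T' < T →
      ∃ β A₀ C δ₀ : ℝ, 0 < β ∧ 0 < δ₀ ∧ ∃ n : ℝ → ℝ → T3 → V3 → ℝ, ∀ δ : ℝ, 0 < δ → δ ≤ δ₀ →
        IsMildBoltzmannSolutionOn T' (Torus.geometry (Fin 3)) hardSphereKernel
          (fun t => δ⁻¹ • n δ t) ∧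
        (∫ z : T3 × V3, n δ 0 z.1 z.2 = 1) ∧
        (∀ t ∈ Icc 0 T', ∀ x v, Real.exp (β / 2 * ‖v‖ ^ 2) * |n δ t x v| ≤ A₀) ∧
        (∀ x y v, |n δ 0 x v - n δ 0 y v| ≤ A₀ * dist x y * Real.exp (-(β / 2) * ‖v‖ ^ 2)) ∧
        (∀ t ∈ Icc 0 T', Measurable (Function.uncurry (n δ t))) ∧
        (∀ t ∈ Icc 0 T', eLpNorm (fun z : T3 × V3 =>
            n δ t z.1 z.2 - localGibbsProfile (ρ t) (u t) (θ t) z) 1 volume ≤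
            ENNReal.ofReal (C * δ))) :
    deng_hani_ma_compressible_euler := by
  classical
  refine deng_hani_ma_compressible_euler_of_kinetic_of_hydrodynamic (fun β hβ => ?_) hProp18
  obtain ⟨c, θ, ε₀, hc, hθ, hε₀, h⟩ := hThm1 β hβ
  refine ⟨fun e => if e ≤ ε₀ then c * Real.sqrt (Real.log |Real.log e|) else 0, fun e => e ^ θ,
    ?_, Literature.Analysis.Asymptotics.tendsto_rpow_nhdsGT_zero_of_pos hθ, ?_⟩
  · -- the truncation at `ε₀` is invisible near `0⁺`
    refine (tendsto_const_mul_sqrt_log_abs_log hc).congr' ?_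
    have hev : ∀ᶠ e in 𝓝[>] (0 : ℝ), e ≤ ε₀ :=
      mem_nhdsWithin_of_mem_nhds (Iic_mem_nhds hε₀)
    exact hev.mono fun e he => (if_pos he).symm
  · intro α A tfin f hα hf hmass hbound hlip ε hε hadm Φ t ht
    dsimp only at hadm ⊢
    have hε₀' : ε ≤ ε₀ := by
      by_contra hcon
      rw [if_neg hcon] at hadm
      have h1 : (1 : ℝ) ≤ max 1 α * max 1 A * max 1 tfin := by
        have := mul_le_mul (mul_le_mul (le_max_left 1 α) (le_max_left 1 A) zero_le_one
          (zero_le_one.trans (le_max_left 1 α))) (le_max_left 1 tfin) zero_le_one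
          (mul_nonneg (zero_le_one.trans (le_max_left 1 α)) (zero_le_one.trans (le_max_left 1 A)))
        simpa using this
      linarith
    rw [if_pos hε₀'] at hadm
    exact h α A tfin f hα hf hmass hbound hlip ε hε hε₀' hadm Φ t ht

end Reduction

end Literature.MathematicalPhysics.KineticTheory

end
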